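import Literature.Computability.Complexity.IntPairBricks
import Literature.Computability.Complexity.IterateFPPoly
import Literature.Computability.Complexity.PRelSigmaPi
import Literature.Computability.Complexity.FPStringBricks
import HarnessLib

/-!
# Integer vector bricks: scaled-row accumulation, matrix–vector products and sums of squares in `FP`

Trunk toolkit continuing `IntPairBricks.lean` (difference-pair integers `ival`, `iaddFn`,
`imulFn`, `ofSMFn`), `BrickAlgebra.lean` (counted loops `Brick.loopStep` on records
`⟨x, ⟨counter, state⟩⟩`, `Brick.loopFn_mem_FP`) and `IterateFPPoly.lean`
(`Brick.loopFn_mem_FP_of_poly`: loops whose rounds grow polynomially, so that loop bricks nest).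
An integer VECTOR is held as the iterated-pair list code `body [u₀, …, uₘ₋₁]`
(`CookReducibilityTransitive.lean`) of difference pairs, read by the total, polynomial-time list
access `PRelSigPi.elemFn ⟨1ⁱ, v⟩ = elemOf v i` (`PRelSigmaPi.lean`). This file provides the three
loops an arithmetic verifier (the `NP` verifier of `GapSVP`,
`Algebra/EuclideanLattices/GapSVPVerifier.lean`) is assembled from:

* `rowLoopFn` — **one scaled row**: on `⟨⟨ents, c⟩, ⟨n, ⟨1ᵏ, body acc⟩⟩⟩` (`ents` a list code of
  sign–magnitude entries, `c` a difference pair, `acc` a list of `n` difference pairs) it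
  returns the index `1ᵏ⁺ⁿ` and the list `body acc'` with `acc'ⱼ = accⱼ + c · ents[k + j]`
  (`rowLoopFn_spec`, values `ival_rowNews`); the accumulator is a QUEUE held in the last field
  (pop the front, append the new entry at the back), so that a round grows the record by an
  amount linear in the fixed field whatever the state (`length_rowBody_le`);
* `matLoopFn` — **all rows**: on `⟨⟨ents, ⟨zs, n⟩⟩, ⟨n, ⟨1⁰, ⟨1⁰, body 0ⁿ⟩⟩⟩⟩` it returns the
  list code of the vector `v = z B`, `vⱼ = ∑ᵢ ival zs[i] · smval ents[i n + j]` (`matLoopFn_spec`),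
  the outer loop running `rowLoopFn` once per row (`Brick.loopFn_mem_FP_of_poly`);
* `sqLoopFn` — **sum of squares** `∑ⱼ (ival v[j])²` of a list read by index (`sqLoopFn_spec`).

All reads of data are BY INDEX from the loop's fixed first field (so their length is bounded by
it on every input) and all specifications are total in the witness-like arguments (`zs`, read
only through `ival ∘ elemOf`), which is what makes a verifier built from these loops sound
against malformed witnesses without any parsing.

## References

* S. Arora, B. Barak, *Computational Complexity: A Modern Approach*, CUP 2009, §1.3 (polynomial
  time is closed under composition and bounded loops), §1.4.1 (clocked simulation).
* D. E. Knuth, *The Art of Computer Programming*, Vol. 2, 3rd ed., 1998, §4.3.1, §4.6.4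
  (evaluation of linear forms / matrix–vector products by accumulation).
-/

namespace Literature.Computability.Complexity

open _root_.Computability OracleCompose PRelSigPi Polynomial

namespace Brick

/-! ### List codes: access, tails, lengths -/

/-- `elemOf v 0 = fstP v`. [folklore] -/
@[simp] theorem elemOf_zero (v : List Bool) : elemOf v 0 = fstP v := rfl

/-- `elemOf v (i + 1) = elemOf (sndP v) i`. [folklore] -/
theorem elemOf_succ (v : List Bool) (i : ℕ) : elemOf v (i + 1) = elemOf (sndP v) i := by
  simp [elemOf, Function.iterate_succ_apply]

/-- Tails never lengthen: `|sndP^[i] v| ≤ |v|`. [folklore] -/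
theorem length_iterate_sndP_le : ∀ (i : ℕ) (v : List Bool), (sndP^[i] v).length ≤ v.length
  | 0, v => le_rfl
  | i + 1, v => by
    rw [Function.iterate_succ_apply]
    exact (length_iterate_sndP_le i (sndP v)).trans (by simpa [sndP] using length_boolUnpair_snd_le_length v)

/-- Entries are within the list: `|elemOf v i| ≤ |v|`. [folklore] -/
theorem length_elemOf_le (v : List Bool) (i : ℕ) : (elemOf v i).length ≤ v.length := by
  have h1 := length_iterate_sndP_le i v
  have h2 := length_boolUnpair_parts_le (sndP^[i] v)
  simp only [elemOf, fstP]
  omega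

/-- An entry and the tail after it are together within the tail before it:
`2 |fstP q| + |sndP q| ≤ |q|`. [folklore] -/
theorem two_mul_length_fstP_add_length_sndP_le (q : List Bool) :
    2 * (fstP q).length + (sndP q).length ≤ q.length :=
  length_boolUnpair_parts_le q

/-- In-range access to a list code. [folklore] -/
theorem elemOf_body_of_lt (l : List (List Bool)) {i : ℕ} (h : i < l.length) : elemOf (body l) i = l[i] := by
  rw [elemOf_body, List.getD_eq_getElem _ _ h]

/-- Out-of-range access to a list code gives `[]`. [folklore] -/
theorem elemOf_body_of_le (l : List (List Bool)) {i : ℕ} (h : l.length ≤ i) : elemOf (body l) i = [] := by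
  rw [elemOf_body, List.getD_eq_default _ _ h]

/-- `body` is a monoid morphism. [folklore] -/
theorem body_append (l l' : List (List Bool)) : body (l ++ l') = body l ++ body l' := by
  induction l with
  | nil => rfl
  | cons a l ih => simp [ih, boolPair, List.append_assoc]

/-- A singleton list code is a pair with empty second component. [folklore] -/
@[simp] theorem body_singleton (a : List Bool) : body [a] = boolPair a [] := rfl

/-- Reading the front of a list code followed by anything. [folklore] -/
theorem fstP_body_cons_append (a : List Bool) (l : List (List Bool)) (t : List Bool) :
    fstP (body (a :: l) ++ t) = a := by
  rw [body_cons, show boolPair a (body l) ++ t = boolPair a (body l ++ t) by simp [boolPair, List.append_assoc],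
    fstP_boolPair]

/-- Dropping the front of a list code followed by anything. [folklore] -/
theorem sndP_body_cons_append (a : List Bool) (l : List (List Bool)) (t : List Bool) :
    sndP (body (a :: l) ++ t) = body l ++ t := by
  rw [body_cons, show boolPair a (body l) ++ t = boolPair a (body l ++ t) by simp [boolPair, List.append_assoc],
    sndP_boolPair]

/-- Length of a list code: the entries doubled plus two separators each (`StockmeyerMachines`
has the same statement; restated to keep the import list short). [folklore] -/
theorem length_body_eq (l : List (List Bool)) : (body l).length = (l.map fun a => 2 * a.length + 2).sum := by
  induction l with
  | nil => rfl
  | cons a l ih => simp [ih]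

/-- The list code of `n` empty strings (the zero vector) has length `2n`. [folklore] -/
theorem length_body_replicate_nil (n : ℕ) : (body (List.replicate n ([] : List Bool))).length = 2 * n := by
  rw [length_body_eq]
  induction n with
  | zero => rfl
  | succ n ih =>
    rw [List.replicate_succ, List.map_cons, List.sum_cons, ih]
    simp; ring


/-! ### The zero vector `body 0ⁿ` from a unary numeral -/

/-- The one-state transducer emitting the empty entry `⟨⟩ = 01` per input symbol. [folklore] -/
def zerosT : FST Unit Bool Bool where
  init := ()
  step := fun _ _ => ((), [false, true])
  front := fun _ => []
  keep := fun _ => true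

/-- `zerosFn u = body (replicate |u| [])`: the list code of `|u|` empty strings (the zero vector
of difference pairs). [folklore] -/
def zerosFn : List Bool → List Bool := zerosT.eval

/-- Value of `zerosFn` on every string. [folklore] -/
theorem zerosFn_apply (u : List Bool) : zerosFn u = body (List.replicate u.length []) := by
  have hrun : ∀ l : List Bool, (zerosT.run () l).2 = body (List.replicate l.length []) := by
    intro l
    induction l with
    | nil => rfl
    | cons b l ih =>
      rw [FST.run_cons]
      simp only [zerosT] at ih ⊢
      rw [ih]
      rfl
  change zerosT.front (zerosT.run () u).1 ++ (if zerosT.keep (zerosT.run () u).1 = true then (zerosT.run () u).2 else []) = _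
  rw [hrun u]
  rfl

/-- `zerosFn ∈ FP`. [cite: AroraBarakCC2009, §1.3] -/
theorem zerosFn_mem_FP : zerosFn ∈ FP := zerosT.polyTimeComputable_eval

/-! ### The loop model as the iteration of a state map -/

/-- If the body of a counted loop ignores the counter, the loop model is the iteration of the
induced state map. [folklore] -/
theorem loopModel_eq_iterate {bd : List Bool → List Bool} {x : List Bool} {g : List Bool → List Bool}
    (h : ∀ c s, bd (boolPair x (boolPair c s)) = g s) : ∀ (k : ℕ) (s : List Bool), loopModel bd x k s = g^[k] s
  | 0, s => rfl
  | k + 1, s => by rw [loopModel, h, loopModel_eq_iterate h k, ← Function.iterate_succ_apply]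

/-- Iterates of the loop step beyond the counter, from a general record (the form used inside
growth estimates): the first field is kept. [folklore] -/
theorem fstF_iterate_loopStep (bd : List Bool → List Bool) (m : ℕ) (z : List Bool) :
    fstF ((loopStep bd)^[m] z) = fstF z := by
  induction m with
  | zero => rfl
  | succ m ih => rw [Function.iterate_succ_apply', fstF_loopStep, ih]

/-! ### One scaled row: `accⱼ + c · ents[k + j]`, `j < n` -/

/-- The new entry of a row round, from the record `⟨⟨ents, c⟩, ⟨cnt, ⟨ku, q⟩⟩⟩`:
`front(q) + c · ofSM(ents[|ku|])`. [cite: KnuthTAOCP2, §4.6.4] -/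
noncomputable def rowNewFn : List Bool → List Bool :=
  iaddFn ∘ fanoutFn (fstF ∘ sndPow 2)
    (imulFn ∘ fanoutFn (sndF ∘ nthF 0) (ofSMFn ∘ elemFn ∘ fanoutFn (nthF 2) (fstF ∘ nthF 0)))

/-- `rowNewFn ∈ FP`. [cite: AroraBarakCC2009, §1.3] -/
theorem rowNewFn_mem_FP : rowNewFn ∈ FP :=
  comp_mem_FP iaddFn_mem_FP (fanoutFn_mem_FP (comp_mem_FP fstF_mem_FP (sndPow_mem_FP 2))
    (comp_mem_FP imulFn_mem_FP (fanoutFn_mem_FP (comp_mem_FP sndF_mem_FP (nthF_mem_FP 0))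
      (comp_mem_FP ofSMFn_mem_FP (comp_mem_FP elemFn_mem_FP (fanoutFn_mem_FP (nthF_mem_FP 2)
        (comp_mem_FP fstF_mem_FP (nthF_mem_FP 0))))))))

/-- Value of `rowNewFn` on a record. [folklore] -/
theorem rowNewFn_apply (ents c cnt ku q : List Bool) :
    rowNewFn (boolPair (boolPair ents c) (boolPair cnt (boolPair ku q))) =
      iaddFn (boolPair (fstP q) (imulFn (boolPair c (ofSMFn (elemOf ents ku.length))))) := by
  simp [rowNewFn, nthF, sndPow, fstF, sndF, elemFn_boolPair, fstP]

/-- **The row round**: `⟨ku, q⟩ ↦ ⟨1 · ku, tail(q) ++ ⟨new, []⟩⟩` — advance the index, pop the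
front accumulator, append the updated one at the back. [cite: KnuthTAOCP2, §4.6.4] -/
noncomputable def rowBody : List Bool → List Bool :=
  fanoutFn (List.cons true ∘ nthF 2) (appendFn ∘ fanoutFn (sndF ∘ sndPow 2) (fanoutFn rowNewFn fun _ => []))

/-- `rowBody ∈ FP`. [cite: AroraBarakCC2009, §1.3] -/
theorem rowBody_mem_FP : rowBody ∈ FP :=
  fanoutFn_mem_FP (comp_mem_FP (cons_mem_FP true) (nthF_mem_FP 2))
    (comp_mem_FP appendFn_mem_FP (fanoutFn_mem_FP (comp_mem_FP sndF_mem_FP (sndPow_mem_FP 2))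
      (fanoutFn_mem_FP rowNewFn_mem_FP (const_mem_FP _))))

/-- The state map of the row loop for fixed `ents`, `c`. [folklore] -/
noncomputable def rowStep (ents c : List Bool) (s : List Bool) : List Bool :=
  boolPair (true :: fstP s)
    (sndP (sndP s) ++ boolPair (iaddFn (boolPair (fstP (sndP s)) (imulFn (boolPair c (ofSMFn (elemOf ents (fstP s).length)))))) [])

/-- The row round on a record is the state map (the counter is ignored). [folklore] -/
theorem rowBody_apply (ents c cnt s : List Bool) :
    rowBody (boolPair (boolPair ents c) (boolPair cnt s)) = rowStep ents c s := by
  have hs : s = boolPair (fstP s) (sndP s) ∨ True := Or.inr trivial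
  simp only [rowBody, fanoutFn_apply, Function.comp_apply, appendFn_boolPair, rowStep]
  congr 1
  · simp [nthF, fstF, sndF, fstP]
  · have h1 : sndF (sndPow 2 (boolPair (boolPair ents c) (boolPair cnt s))) = sndP (sndP s) := by
      simp [sndPow, sndF, sndP]
    have h2 : rowNewFn (boolPair (boolPair ents c) (boolPair cnt s)) =
        iaddFn (boolPair (fstP (sndP s)) (imulFn (boolPair c (ofSMFn (elemOf ents (fstP s).length))))) := by
      simp [rowNewFn, nthF, sndPow, fstF, sndF, elemFn, nthRest, elemOf, fstP, sndP]
    rw [h1, h2]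

/-- **Growth of a row round is linear in the fixed field, on every record.**
`|rowBody z| ≤ |sndPow 1 z| + 38 (|fstF z| + 1)`. [folklore] -/
theorem length_rowBody_le (z : List Bool) : (rowBody z).length ≤ (sndPow 1 z).length + 38 * ((fstF z).length + 1) := by
  -- the pieces of the record: `x = fstF z`, `s = sndPow 1 z = ⟨ku, q⟩`, `x = ⟨ents, c⟩`
  have hku : nthF 2 z = fstF (sndPow 1 z) := by simp [nthF, sndPow, fstF, sndF]
  have hq : sndPow 2 z = sndF (sndPow 1 z) := by simp [sndPow]
  have hsplit := length_fstF_sndF_le (sndPow 1 z)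
  have hqsplit := length_fstF_sndF_le (sndF (sndPow 1 z))
  have hxsplit := length_fstF_sndF_le (fstF z)
  -- the new entry
  have hnew : rowNewFn z = iaddFn (boolPair (fstF (sndF (sndPow 1 z)))
      (imulFn (boolPair (sndF (fstF z)) (ofSMFn (elemOf (fstF (fstF z)) (fstF (sndPow 1 z)).length))))) := by
    simp only [rowNewFn, Function.comp_apply, fanoutFn_apply, hku, hq, elemFn_boolPair]
    rfl
  have he : (elemOf (fstF (fstF z)) (fstF (sndPow 1 z)).length).length ≤ (fstF (fstF z)).length := length_elemOf_le _ _
  have he' := length_ofSMFn_le (elemOf (fstF (fstF z)) (fstF (sndPow 1 z)).length)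
  have hmul := length_imulFn_boolPair_le (sndF (fstF z)) (ofSMFn (elemOf (fstF (fstF z)) (fstF (sndPow 1 z)).length))
  have hadd := length_iaddFn_boolPair_le (fstF (sndF (sndPow 1 z)))
    (imulFn (boolPair (sndF (fstF z)) (ofSMFn (elemOf (fstF (fstF z)) (fstF (sndPow 1 z)).length))))
  have hbody : rowBody z = boolPair (true :: fstF (sndPow 1 z)) (sndF (sndF (sndPow 1 z)) ++ boolPair (rowNewFn z) []) := by
    simp only [rowBody, fanoutFn_apply, Function.comp_apply, appendFn_boolPair, hku, hq]
  rw [hbody, length_boolPair, List.length_append, length_boolPair, hnew, List.length_cons, List.length_nil]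
  omega

/-- **The row loop**: `|⟨ents, c⟩|` rounds of `loopStep rowBody` (at least the counter).
[cite: KnuthTAOCP2, §4.6.4] -/
noncomputable def rowLoopFn (z : List Bool) : List Bool := (loopStep rowBody)^[X.eval (fstF z).length] z

/-- **`rowLoopFn ∈ FP`** (a counted loop of linear growth). [cite: AroraBarakCC2009, §1.3] -/
theorem rowLoopFn_mem_FP : rowLoopFn ∈ FP :=
  loopFn_mem_FP rowBody_mem_FP (c := 38) length_rowBody_le X

/-- The new entries of a row: `accⱼ + c · ofSM(ents[k + j])`, `j < n`, as strings. [folklore] -/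
noncomputable def rowNews (ents c : List Bool) (k : ℕ) (acc : List (List Bool)) (n : ℕ) : List (List Bool) :=
  List.ofFn fun j : Fin n => iaddFn (boolPair (acc.getD j []) (imulFn (boolPair c (ofSMFn (elemOf ents (k + j))))))

/-- Length of `rowNews`. [folklore] -/
@[simp] theorem length_rowNews (ents c : List Bool) (k : ℕ) (acc : List (List Bool)) (n : ℕ) :
    (rowNews ents c k acc n).length = n := by simp [rowNews]

/-- **Values of the new entries**: `ival (acc'ⱼ) = ival accⱼ + ival c · smval ents[k + j]`.
[cite: KnuthTAOCP2, §4.6.4] -/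
theorem ival_rowNews (ents c : List Bool) (k : ℕ) (acc : List (List Bool)) (n : ℕ) (j : ℕ) (hj : j < n) :
    ival ((rowNews ents c k acc n).getD j []) = ival (acc.getD j []) + ival c * smval (elemOf ents (k + j)) := by
  rw [rowNews, List.getD_eq_getElem _ _ (by simpa using hj), List.getElem_ofFn]
  simp

/-- The row invariant: after `j ≤ n` rounds from `⟨1ᵏ, body acc⟩` (`|acc| = n`) the state is
`⟨1ᵏ⁺ʲ, body (acc.drop j ++ news_j)⟩`. [folklore] -/
theorem iterate_rowStep (ents c : List Bool) (k : ℕ) (acc : List (List Bool)) :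
    ∀ j : ℕ, j ≤ acc.length →
      (rowStep ents c)^[j] (boolPair (List.replicate k true) (body acc)) =
        boolPair (List.replicate (k + j) true) (body (acc.drop j ++ rowNews ents c k acc j))
  | 0, _ => by simp [rowNews]
  | j + 1, hj => by
    rw [Function.iterate_succ_apply', iterate_rowStep ents c k acc j (by omega), rowStep, fstP_boolPair, sndP_boolPair,
      List.length_replicate]
    have hdrop : acc.drop j = acc.getD j [] :: acc.drop (j + 1) := by
      rw [List.getD_eq_getElem _ _ (by omega)]
      exact (List.getElem_cons_drop (by omega)).symm
    rw [hdrop, List.cons_append, body_cons, fstP_boolPair, sndP_boolPair]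
    congr 1
    rw [← body_singleton, ← body_append, List.append_assoc]
    congr 2
    simp only [rowNews, List.ofFn_succ', List.concat_eq_append, Fin.val_castSucc, Fin.val_last]

/-- **Specification of the row loop**: from `⟨⟨ents, c⟩, ⟨n, ⟨1ᵏ, body acc⟩⟩⟩` with `|acc| = n`
and `n ≤ |⟨ents, c⟩|`, the loop ends with counter `0`, index `1ⁿ⁺ᵏ` and the list code of the
updated row. [cite: KnuthTAOCP2, §4.6.4] -/
theorem rowLoopFn_spec (ents c : List Bool) (k : ℕ) (acc : List (List Bool))
    (hn : acc.length ≤ (boolPair ents c).length) :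
    rowLoopFn (boolPair (boolPair ents c) (boolPair (encodeNat acc.length) (boolPair (List.replicate k true) (body acc)))) =
      boolPair (boolPair ents c) (boolPair []
        (boolPair (List.replicate (k + acc.length) true) (body (rowNews ents c k acc acc.length)))) := by
  rw [rowLoopFn, show fstF (boolPair (boolPair ents c) (boolPair (encodeNat acc.length)
      (boolPair (List.replicate k true) (body acc)))) = boolPair ents c by simp [fstF], eval_X,
    iterate_loopStep rowBody _ acc.length _ _ hn,
    loopModel_eq_iterate (g := rowStep ents c) (fun cnt s => rowBody_apply ents c cnt s),
    iterate_rowStep ents c k acc acc.length le_rfl, List.drop_length, List.nil_append]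

/-- **Size of the row loop's result** from a general record: `m` rounds add at most
`m · 42 (|x| + 1)`. [folklore] -/
theorem length_iterate_loopStep_rowBody_le (m : ℕ) (z : List Bool) :
    ((loopStep rowBody)^[m] z).length ≤ z.length + m * (42 * ((fstF z).length + 1)) :=
  length_iterate_le_of_growth 42 (fun w => fstF_loopStep rowBody w) (fun w => length_loopStep_le length_rowBody_le w) z m

/-! ### All rows: the matrix–vector product `z B` accumulated row by row -/

/-- The record of the matrix loop is `⟨⟨ents, ⟨zs, nc⟩⟩, ⟨cnt, ⟨iu, ⟨ku, acc⟩⟩⟩⟩`; the inner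
record handed to the row loop is `⟨⟨ents, zs[|iu|]⟩, ⟨nc, ⟨ku, acc⟩⟩⟩`. [cite: KnuthTAOCP2, §4.6.4] -/
noncomputable def matSetupFn : List Bool → List Bool :=
  fanoutFn (fanoutFn (fstF ∘ nthF 0) (elemFn ∘ fanoutFn (nthF 2) (nthF 1 ∘ nthF 0)))
    (fanoutFn (sndPow 1 ∘ nthF 0) (sndPow 2))

/-- `matSetupFn ∈ FP`. [cite: AroraBarakCC2009, §1.3] -/
theorem matSetupFn_mem_FP : matSetupFn ∈ FP :=
  fanoutFn_mem_FP (fanoutFn_mem_FP (comp_mem_FP fstF_mem_FP (nthF_mem_FP 0))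
      (comp_mem_FP elemFn_mem_FP (fanoutFn_mem_FP (nthF_mem_FP 2) (comp_mem_FP (nthF_mem_FP 1) (nthF_mem_FP 0)))))
    (fanoutFn_mem_FP (comp_mem_FP (sndPow_mem_FP 1) (nthF_mem_FP 0)) (sndPow_mem_FP 2))

/-- Value of `matSetupFn` on a record. [folklore] -/
theorem matSetupFn_apply (ents zs nc cnt iu t : List Bool) :
    matSetupFn (boolPair (boolPair ents (boolPair zs nc)) (boolPair cnt (boolPair iu t))) =
      boolPair (boolPair ents (elemOf zs iu.length)) (boolPair nc t) := by
  simp [matSetupFn, nthF, sndPow, fstF, sndF, elemFn_boolPair]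

/-- **The matrix round**: `⟨iu, ⟨ku, acc⟩⟩ ↦ ⟨1 · iu, (ku, acc) after the row loop with
multiplier zs[|iu|]⟩`. [cite: KnuthTAOCP2, §4.6.4] -/
noncomputable def matBody : List Bool → List Bool :=
  fanoutFn (List.cons true ∘ nthF 2) (sndPow 1 ∘ rowLoopFn ∘ matSetupFn)

/-- `matBody ∈ FP`. [cite: AroraBarakCC2009, §1.3] -/
theorem matBody_mem_FP : matBody ∈ FP :=
  fanoutFn_mem_FP (comp_mem_FP (cons_mem_FP true) (nthF_mem_FP 2))
    (comp_mem_FP (sndPow_mem_FP 1) (comp_mem_FP rowLoopFn_mem_FP matSetupFn_mem_FP))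

/-- Structural size facts of a record: the tail after field `1` together with the doubled
fields `0`, `1` is within the record. [folklore] -/
theorem length_sndPow_one_add_le (r : List Bool) :
    (sndPow 1 r).length + 2 * (fstF r).length + 2 * (nthF 1 r).length ≤ r.length := by
  have h0 := length_fstF_sndF_le r
  have h1 := length_nthF_succ_add_sndPow_succ_le 0 r
  simp only [sndPow_zero] at h1
  simp only [nthF, sndPow, Function.comp_apply] at h1 ⊢
  omega

/-- **Growth of a matrix round is polynomial in the fixed field, on every record.**
[folklore] -/
theorem length_matBody_le (z : List Bool) :
    (matBody z).length ≤ (sndPow 1 z).length + (2 * X + 8 + 126 * (X + 1) * (3 * X + 3)).eval (fstF z).length := by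
  -- names: `x = fstF z = ⟨ents, ⟨zs, nc⟩⟩`, `sndPow 1 z = ⟨iu, t⟩`
  have hiu : nthF 2 z = fstF (sndPow 1 z) := by simp [nthF, sndPow, fstF, sndF]
  have ht : sndPow 2 z = sndF (sndPow 1 z) := by simp [sndPow]
  have hst := length_fstF_sndF_le (sndPow 1 z)
  have hxsplit := length_fstF_sndF_le (fstF z)
  have hx1 := length_nthF_succ_add_sndPow_succ_le 0 (fstF z)
  simp only [sndPow_zero, Nat.zero_add] at hx1
  have hc : (elemOf (nthF 1 (fstF z)) (fstF (sndPow 1 z)).length).length ≤ (nthF 1 (fstF z)).length :=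
    length_elemOf_le _ _
  -- the inner record `zin = ⟨xin, ⟨nc, t⟩⟩`, `xin = ⟨ents, c⟩`
  have hsetup : matSetupFn z = boolPair (boolPair (fstF (fstF z)) (elemOf (nthF 1 (fstF z)) (fstF (sndPow 1 z)).length))
      (boolPair (sndPow 1 (fstF z)) (sndF (sndPow 1 z))) := by
    simp only [matSetupFn, fanoutFn_apply, Function.comp_apply, elemFn_boolPair, hiu, ht]
    rfl
  set xin := boolPair (fstF (fstF z)) (elemOf (nthF 1 (fstF z)) (fstF (sndPow 1 z)).length) with hxin
  set zin := boolPair xin (boolPair (sndPow 1 (fstF z)) (sndF (sndPow 1 z))) with hzin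
  have hxinlen : xin.length ≤ 3 * (fstF z).length + 2 := by rw [hxin, length_boolPair]; omega
  have hzinlen : zin.length = 2 * xin.length + 2 + (2 * (sndPow 1 (fstF z)).length + 2 + (sndF (sndPow 1 z)).length) := by
    simp only [hzin, length_boolPair]
  have hfz : fstF zin = xin := by simp [hzin, fstF]
  -- the row loop from the inner record: `m = |xin|` rounds
  have hrow : rowLoopFn zin = (loopStep rowBody)^[xin.length] zin := by rw [rowLoopFn, hfz, eval_X]
  have hrlen := length_iterate_loopStep_rowBody_le xin.length zin
  rw [hfz] at hrlen
  have hrfst : fstF ((loopStep rowBody)^[xin.length] zin) = xin := by rw [fstF_iterate_loopStep, hfz]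
  have hrstruct := length_sndPow_one_add_le ((loopStep rowBody)^[xin.length] zin)
  rw [hrfst] at hrstruct
  have hbody : matBody z = boolPair (true :: fstF (sndPow 1 z)) (sndPow 1 ((loopStep rowBody)^[xin.length] zin)) := by
    simp only [matBody, fanoutFn_apply, Function.comp_apply, hsetup, hrow, hiu]
  rw [hbody, length_boolPair, List.length_cons]
  simp only [eval_add, eval_mul, eval_ofNat, eval_X, eval_one]
  have key : (sndPow 1 ((loopStep rowBody)^[xin.length] zin)).length ≤
      (sndF (sndPow 1 z)).length + 2 * (sndPow 1 (fstF z)).length + 4 + xin.length * (42 * (xin.length + 1)) := by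
    omega
  have hm2 : xin.length * (42 * (xin.length + 1)) ≤ (3 * (fstF z).length + 2) * (42 * (3 * (fstF z).length + 3)) :=
    Nat.mul_le_mul hxinlen (Nat.mul_le_mul_left 42 (by omega))
  nlinarith [key, hm2, hst, hx1, hxsplit]

/-- **The matrix loop**: `|⟨ents, ⟨zs, nc⟩⟩|` rounds of `loopStep matBody`. [cite: KnuthTAOCP2, §4.6.4] -/
noncomputable def matLoopFn (z : List Bool) : List Bool := (loopStep matBody)^[X.eval (fstF z).length] z

/-- **`matLoopFn ∈ FP`**: a counted loop whose rounds (row loops) grow polynomially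
(`loopFn_mem_FP_of_poly`). [cite: AroraBarakCC2009, §1.3] -/
theorem matLoopFn_mem_FP : matLoopFn ∈ FP :=
  loopFn_mem_FP_of_poly matBody_mem_FP (2 * X + 8 + 126 * (X + 1) * (3 * X + 3)) length_matBody_le X

/-- The accumulator rows of the matrix loop: `acc₀ = 0ⁿ`, `accᵢ₊₁ = accᵢ + zs[i] · (row i)`,
as lists of strings. [cite: KnuthTAOCP2, §4.6.4] -/
noncomputable def matAcc (ents zs : List Bool) (n : ℕ) : ℕ → List (List Bool)
  | 0 => List.replicate n []
  | i + 1 => rowNews ents (elemOf zs i) (i * n) (matAcc ents zs n i) n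

/-- `matAcc` has `n` rows. [folklore] -/
@[simp] theorem length_matAcc (ents zs : List Bool) (n : ℕ) : ∀ i, (matAcc ents zs n i).length = n
  | 0 => by simp [matAcc]
  | i + 1 => by simp [matAcc]

/-- **Values of the accumulator**: `ival (accᵢ[j]) = ∑_{i' < i} ival zs[i'] · smval ents[i' n + j]`.
[cite: KnuthTAOCP2, §4.6.4] -/
theorem ival_matAcc (ents zs : List Bool) (n : ℕ) {j : ℕ} (hj : j < n) : ∀ i : ℕ,
    ival ((matAcc ents zs n i).getD j []) =
      ∑ i' ∈ Finset.range i, ival (elemOf zs i') * smval (elemOf ents (i' * n + j))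
  | 0 => by
    rw [matAcc, List.getD_eq_getElem _ _ (by simpa using hj)]
    simp
  | i + 1 => by
    rw [matAcc, ival_rowNews _ _ _ _ _ _ hj, ival_matAcc ents zs n hj i, Finset.sum_range_succ]

/-- The state map of the matrix loop for fixed `ents`, `zs`, `nc`. [folklore] -/
noncomputable def matStep (ents zs nc : List Bool) (s : List Bool) : List Bool :=
  boolPair (true :: fstP s) (sndPow 1 (rowLoopFn (boolPair (boolPair ents (elemOf zs (fstP s).length)) (boolPair nc (sndP s)))))

/-- The matrix round on a record is the state map. [folklore] -/
theorem matBody_apply (ents zs nc cnt s : List Bool) :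
    matBody (boolPair (boolPair ents (boolPair zs nc)) (boolPair cnt s)) = matStep ents zs nc s := by
  have h1 : matSetupFn (boolPair (boolPair ents (boolPair zs nc)) (boolPair cnt s)) =
      boolPair (boolPair ents (elemOf zs (fstP s).length)) (boolPair nc (sndP s)) := by
    simp only [matSetupFn, fanoutFn_apply, Function.comp_apply, elemFn_boolPair]
    simp [nthF, sndPow, fstF, sndF, fstP, sndP]
  have h2 : nthF 2 (boolPair (boolPair ents (boolPair zs nc)) (boolPair cnt s)) = fstP s := by
    simp [nthF, fstF, sndF, fstP]
  unfold matBody matStep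
  rw [fanoutFn_apply]
  rw [Function.comp_apply, Function.comp_apply, Function.comp_apply]
  rw [h2]
  rw [h1]

/-- The matrix invariant: after `i ≤ n` rounds the state is `⟨1ⁱ, ⟨1ⁱⁿ, body accᵢ⟩⟩`.
[folklore] -/
theorem iterate_matStep (ents zs : List Bool) (n : ℕ) (hn : n ≤ ents.length) :
    ∀ i : ℕ, (matStep ents zs (encodeNat n))^[i] (boolPair [] (boolPair [] (body (List.replicate n [])))) =
      boolPair (List.replicate i true) (boolPair (List.replicate (i * n) true) (body (matAcc ents zs n i)))
  | 0 => by simp [matAcc]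
  | i + 1 => by
    rw [Function.iterate_succ_apply', iterate_matStep ents zs n hn i, matStep, fstP_boolPair, sndP_boolPair,
      List.length_replicate]
    have hlen : (matAcc ents zs n i).length = n := length_matAcc _ _ _ _
    have hspec := rowLoopFn_spec ents (elemOf zs i) (i * n) (matAcc ents zs n i)
      (by rw [hlen, length_boolPair]; omega)
    rw [hlen] at hspec
    rw [hspec]
    have hproj : ∀ A B : List Bool, sndPow 1 (boolPair A (boolPair [] B)) = B := fun A B => by simp [sndPow, sndF]
    rw [hproj, Nat.succ_mul, List.replicate_succ]
    rfl

/-- **Specification of the matrix loop**: from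
`⟨⟨ents, ⟨zs, n⟩⟩, ⟨n, ⟨1⁰, ⟨1⁰, body 0ⁿ⟩⟩⟩⟩` with `n ≤ |ents|`, the loop ends with counter `0`
and the list code of `acc_n`, the vector `z B`. [cite: KnuthTAOCP2, §4.6.4] -/
theorem matLoopFn_spec (ents zs : List Bool) (n : ℕ) (hn : n ≤ ents.length) :
    matLoopFn (boolPair (boolPair ents (boolPair zs (encodeNat n)))
        (boolPair (encodeNat n) (boolPair [] (boolPair [] (body (List.replicate n [])))))) =
      boolPair (boolPair ents (boolPair zs (encodeNat n))) (boolPair []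
        (boolPair (List.replicate n true) (boolPair (List.replicate (n * n) true) (body (matAcc ents zs n n))))) := by
  have hx : fstF (boolPair (boolPair ents (boolPair zs (encodeNat n)))
      (boolPair (encodeNat n) (boolPair [] (boolPair [] (body (List.replicate n [])))))) =
      boolPair ents (boolPair zs (encodeNat n)) := by simp [fstF]
  have hrounds : n ≤ X.eval (boolPair ents (boolPair zs (encodeNat n))).length := by
    rw [eval_X, length_boolPair]; omega
  rw [matLoopFn, hx, iterate_loopStep matBody _ n _ _ hrounds,
    loopModel_eq_iterate (g := matStep ents zs (encodeNat n)) (fun cnt s => matBody_apply ents zs _ cnt s),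
    iterate_matStep ents zs n hn n]

/-! ### Sum of squares of a list read by index -/

/-- The entry read in a squares round, from `⟨v, ⟨cnt, ⟨ju, S⟩⟩⟩`: `v[|ju|]`. [folklore] -/
noncomputable def sqEntryFn : List Bool → List Bool := elemFn ∘ fanoutFn (nthF 2) (nthF 0)

/-- `sqEntryFn ∈ FP`. [cite: AroraBarakCC2009, §1.3] -/
theorem sqEntryFn_mem_FP : sqEntryFn ∈ FP :=
  comp_mem_FP elemFn_mem_FP (fanoutFn_mem_FP (nthF_mem_FP 2) (nthF_mem_FP 0))

/-- **The squares round**: `⟨ju, S⟩ ↦ ⟨1 · ju, S + v[|ju|]²⟩`. [cite: KnuthTAOCP2, §4.6.4] -/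
noncomputable def sqBody : List Bool → List Bool :=
  fanoutFn (List.cons true ∘ nthF 2) (iaddFn ∘ fanoutFn (sndPow 2) (imulFn ∘ fanoutFn sqEntryFn sqEntryFn))

/-- `sqBody ∈ FP`. [cite: AroraBarakCC2009, §1.3] -/
theorem sqBody_mem_FP : sqBody ∈ FP :=
  fanoutFn_mem_FP (comp_mem_FP (cons_mem_FP true) (nthF_mem_FP 2))
    (comp_mem_FP iaddFn_mem_FP (fanoutFn_mem_FP (sndPow_mem_FP 2)
      (comp_mem_FP imulFn_mem_FP (fanoutFn_mem_FP sqEntryFn_mem_FP sqEntryFn_mem_FP))))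

/-- The state map of the squares loop for a fixed list `v`. [folklore] -/
noncomputable def sqStep (v : List Bool) (s : List Bool) : List Bool :=
  boolPair (true :: fstP s) (iaddFn (boolPair (sndP s)
    (imulFn (boolPair (elemOf v (fstP s).length) (elemOf v (fstP s).length)))))

/-- The squares round on a record is the state map. [folklore] -/
theorem sqBody_apply (v cnt s : List Bool) : sqBody (boolPair v (boolPair cnt s)) = sqStep v s := by
  simp [sqBody, sqStep, sqEntryFn, nthF, sndPow, fstF, sndF, elemFn_boolPair, fstP, sndP]

/-- **Growth of a squares round is linear in the fixed field, on every record.** [folklore] -/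
theorem length_sqBody_le (z : List Bool) : (sqBody z).length ≤ (sndPow 1 z).length + 14 * ((fstF z).length + 1) := by
  set v := fstF z with hv
  set s := sndPow 1 z with hs
  set ju := nthF 2 z with hju
  set S := sndPow 2 z with hS
  have hst : 2 * ju.length + S.length ≤ s.length := by
    have := length_nthF_succ_add_sndPow_succ_le 1 z
    simpa [hju, hS, hs] using this
  set a := elemOf v ju.length
  have hentry : sqEntryFn z = a := by
    simp only [sqEntryFn, Function.comp_apply, fanoutFn_apply, elemFn_boolPair]
    rfl
  have ha : a.length ≤ v.length := length_elemOf_le _ _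
  have hmul := length_imulFn_boolPair_le a a
  have hadd := length_iaddFn_boolPair_le S (imulFn (boolPair a a))
  have hbody : sqBody z = boolPair (true :: ju) (iaddFn (boolPair S (imulFn (boolPair a a)))) := by
    simp only [sqBody, fanoutFn_apply, Function.comp_apply, hentry, hju, hS]
  rw [hbody, length_boolPair, List.length_cons]
  nlinarith [hst, ha, hmul, hadd]

/-- **The squares loop**: `|v|` rounds of `loopStep sqBody`. [cite: KnuthTAOCP2, §4.6.4] -/
noncomputable def sqLoopFn (z : List Bool) : List Bool := (loopStep sqBody)^[X.eval (fstF z).length] z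

/-- **`sqLoopFn ∈ FP`.** [cite: AroraBarakCC2009, §1.3] -/
theorem sqLoopFn_mem_FP : sqLoopFn ∈ FP :=
  loopFn_mem_FP sqBody_mem_FP (c := 14) length_sqBody_le X

/-- The accumulated sum of squares after `j` rounds, as a string: `S₀ = ε`,
`Sⱼ₊₁ = Sⱼ + v[j]²`. [folklore] -/
noncomputable def sqAcc (v : List Bool) : ℕ → List Bool
  | 0 => []
  | j + 1 => iaddFn (boolPair (sqAcc v j) (imulFn (boolPair (elemOf v j) (elemOf v j))))

/-- **Value of the accumulated sum**: `ival Sⱼ = ∑_{t < j} (ival v[t])²`. [cite: KnuthTAOCP2, §4.6.4] -/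
theorem ival_sqAcc (v : List Bool) : ∀ j : ℕ, ival (sqAcc v j) = ∑ t ∈ Finset.range j, ival (elemOf v t) ^ 2
  | 0 => by simp [sqAcc]
  | j + 1 => by rw [sqAcc, ival_iaddFn_boolPair, ival_imulFn_boolPair, ival_sqAcc v j, Finset.sum_range_succ, sq]

/-- The squares invariant. [folklore] -/
theorem iterate_sqStep (v : List Bool) :
    ∀ j : ℕ, (sqStep v)^[j] (boolPair [] []) = boolPair (List.replicate j true) (sqAcc v j)
  | 0 => rfl
  | j + 1 => by
    rw [Function.iterate_succ_apply', iterate_sqStep v j, sqStep, fstP_boolPair, sndP_boolPair, List.length_replicate]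
    simp [sqAcc, List.replicate_succ]

/-- **Specification of the squares loop**: from `⟨v, ⟨n, ⟨1⁰, ε⟩⟩⟩` with `n ≤ |v|`, the loop ends
with counter `0`, index `1ⁿ` and the accumulated sum `Sₙ`. [cite: KnuthTAOCP2, §4.6.4] -/
theorem sqLoopFn_spec (v : List Bool) (n : ℕ) (hn : n ≤ v.length) :
    sqLoopFn (boolPair v (boolPair (encodeNat n) (boolPair [] []))) =
      boolPair v (boolPair [] (boolPair (List.replicate n true) (sqAcc v n))) := by
  have hx : fstF (boolPair v (boolPair (encodeNat n) (boolPair [] []))) = v := by simp [fstF]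
  rw [sqLoopFn, hx, eval_X, iterate_loopStep sqBody _ n _ _ hn,
    loopModel_eq_iterate (g := sqStep v) (fun cnt s => sqBody_apply v cnt s), iterate_sqStep v n]

end Brick

end Literature.Computability.Complexity
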